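import Summits.BirchSwinnertonDyer.BirchSwinnertonDyer.Theorems.ClassRecordThreeEulerHalvesAtThreeSection6Joined
import Summits.BirchSwinnertonDyer.BirchSwinnertonDyer.Theorems.ClassRecordThreeEulerHalvesAtThreeWalkConductors
import Summits.BirchSwinnertonDyer.BirchSwinnertonDyer.Theorems.ClassRecordThreeEulerHalvesAtThreeWalkStructures
import Summits.BirchSwinnertonDyer.BirchSwinnertonDyer.Theorems.KolyvaginRoadThreeMethod2Step
import Summits.BirchSwinnertonDyer.Rank1Residual.X11b.Three.KolyvaginLine
import HarnessLib

/-!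
# The Jetchev WALK on the row objects, SHARP form: data only at ADMISSIBLE conductors, Prop. 4.7 as a
# conclusion-shaped input, no CM ∕ tower ∕ discriminant ∕ Heegner binder — the kernel §6
# (`JET.Section6.tamagawaExponent_le_m_of_selmerFamilies`) instantiated on `H¹(K, E[p^k])`
# (cell `bsd-stepL`, seat `bsd-stepL-tam3-p1`, helper toward item 19109 `EulerHalvesAtThree`,
# registered stub `stub_jetchevMaxHLAtThree`)

HONEST FRAMING. Nothing here proves BSD, J₃ or the divisibility of any Heegner point; the registered
stub is NOT discharged — this theorem has hypothesis-shaped binders that nothing in the tree supplies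
yet; no item closes; 0 classes move (T7); `--supports stmt-BirchSwinnertonDyer-19109` (helper).
WHAT THIS FILE DOES. `tamagawaExponent_le_m_of_admissibleFamilies` is the sibling of
`tamagawaExponent_le_m_of_rowFamilies` (`…WalkFamilies`, p496626) with three repairs of its INPUT
SHAPES (same kernel, same dictionary, same conclusion `(t : ℕ∞) ≤ m(c)` = the `hlev` clause of
`Koly.jetchevMaxHLAtThree_of_facts_of_perLevel`, p490155):
1. the Kolyvagin–Heegner DATA are required only at ADMISSIBLE conductors — the subtype
   `{m // Squarefree m ∧ every prime factor is a Kolyvagin prime (Zhang, N = N_E) of index ≥ k}`,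
   closed under divisors and under `m ↦ mℓ` for fresh admissible `ℓ` — instead of a total
   `∀ m, KolyvaginHeegnerData Dt β ι m` (which presupposes data at conductors where the type may be
   empty); every per-conductor hypothesis is quantified over that subtype;
2. Prop. 4.7 enters in CONCLUSION form `h47` (`ord loc_λ c_k(mℓ) = ord loc_λ c_k(m)` for the data of
   the system at `m` and at `mℓ`) — dischargeable from the typed McCallum Prop. 4.4 for COMPATIBLE data
   (bsd-jet's `JET.addOrderOf_localization_kolyvaginClass_mul_eq_of_prop44`) composed with the
   choice-independence of orders (x11b3's `kolyvaginClass_eq_smul_of_sameLevel`: same-conductor data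
   give unit multiples), so NO coherent system of choices over all conductors is presupposed;
3. consequently the frame needs only `K` imaginary quadratic, `p` odd, `ρ̄_{E,p}` onto (for the
   kernel Lemma 6.1, `…WalkCebotarev` p494064) — no CM, `p`-adic tower, `d_K`, Heegner binder, no
   `NumberField (ringClassField …)` instance, no typed fact.
DISCHARGED HERE: as in p496626 (`hSel`, `hSelT`, `hSelGs`, `he`, `hm`, `hM`, `h0`, `h61` kernel,
`hB'A'`, admissibility ∕ place bookkeeping, choice ∕ totalisation of block 2). NAMED HYPOTHESES LEFT
(concrete, over admissible conductors): `hdisj`, `hfin`, `hPT`, `hκt` (S7♯), `hordκ` (S7 — see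
`…WalkOrders`), `h47` (Prop. 4.7), `hC`, `hdual_q`, `h49`, `hdual_ℓ`.
References (locators only; no cited FACT declared): [cite: Jetchev2008, §3.1, §4.2–4.3, Prop. 4.7,
Prop. 4.9, Thm. 5.1, Lemma 5.2, Lemma 6.1, Thm. 6.3, Prop. 6.4, Proof of Thm. 1.4 (pp. 816–825)]
[cite: McCallumLMS1991, §3 Cor. 3.2, §4 Prop. 4.4, §5 (p. 303)] [cite: WZhang2014, Notations (xii)].
Design: one theorem, no definitions; `K : Type`. Axioms: `propext`, `Classical.choice`, `Quot.sound`.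
-/

set_option autoImplicit false

noncomputable section

open scoped Classical NumberField

namespace Summit.BirchSwinnertonDyer.Rank1Residual.X11b.Three.Koly

open WeierstrassCurve IsDedekindDomain NumberField Literature.NumberTheory.EllipticCurves
  Literature.NumberTheory.EllipticCurves.ModularForms Literature.NumberTheory.EllipticCurves.Jetchev2008
  Literature.NumberTheory.GaloisRepresentations
  Literature.NumberTheory.GaloisRepresentations.DiscreteGaloisModule
  Summit.BirchSwinnertonDyer.Rank1Residual.JET

/-- **The kernel §6 walk ([J] Prop. 6.4 ∘ Thm. 6.3) on the row objects, sharp input shapes: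
`ord_p c_q ≤ m(c)`.** Data `D` on the admissible conductors (square-free, Kolyvagin prime factors of
index `≥ k`); frame: `K` imaginary quadratic, `p` odd, `ρ̄_{E,p}` onto, `τ ≠ 1`; inputs discharged and
named as in the module docstring. CONCLUSION: `(t : ℕ∞) ≤ m(c)` (McCallum's `m` on `Koly.divOrd`,
`Zhang2014.levelIndex`) — the `hlev` clause of `Koly.jetchevMaxHLAtThree_of_facts_of_perLevel` at
`(k, c, D c)`. [cite: Jetchev2008, Prop. 6.4, Thm. 6.3, Proof of Thm. 1.4 (pp. 822–825)]
[cite: McCallumLMS1991, §3 Cor. 3.2, §4 Prop. 4.4] -/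
theorem tamagawaExponent_le_m_of_admissibleFamilies
    (W : WeierstrassCurve ℚ) [W.IsElliptic] [W.IsGloballyMinimal] [NeZero (W.conductorNorm ℤ)]
    (K : Type) [Field K] [NumberField K] (hK : IsImaginaryQuadratic K)
    (p : ℕ) [Fact p.Prime] (hp2 : p ≠ 2) (hρ : W.HasSurjectiveModNGaloisRep p)
    (Dt : ModularParametrizationData W (W.conductorNorm ℤ)) (β : ℤ) (ι : K →+* ℂ)
    (τ : K ≃ₐ[ℚ] K) (hτ : τ ≠ 1) (k t : ℕ) (hk : 1 ≤ k) (htk : t ≤ k)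
    (𝒯 𝒮 : SelmerStructure ((W.baseChange K).torsionGaloisModule ((p ^ k : ℕ) : ℤ)))
    (hS : ∀ v, 𝒮 v ≤ (W.baseChange K).kummerSelmerStructure ((p ^ k : ℕ) : ℤ) v)
    (Qcar : Finset (HeightOneSpectrum (𝓞 K)))
    (hQcar : ∀ v ∈ Qcar, ((W.conductorNorm ℤ : ℕ) : 𝓞 K) ∈ v.asIdeal)
    (D : ∀ s : {m : ℕ // Squarefree m ∧ ∀ q ∈ m.primeFactors,
        Zhang2014.IsKolyvaginPrime (W.conductorNorm ℤ) W K p q ∧ k ≤ Zhang2014.kolyvaginIndex W p q},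
      KolyvaginHeegnerData Dt β ι s.1)
    (eb : ℕ → Bool) (heb : ∀ (m ℓ : ℕ), ℓ.Prime → ¬ ℓ ∣ m → eb (m * ℓ) = !eb m)
    (c : ℕ) (hc : Squarefree c ∧ ∀ q ∈ c.primeFactors,
      Zhang2014.IsKolyvaginPrime (W.conductorNorm ℤ) W K p q ∧ k ≤ Zhang2014.kolyvaginIndex W p q)
    (h0 : (if divOrd (D ⟨c, hc⟩) p < Zhang2014.levelIndex W p c then divOrd (D ⟨c, hc⟩) p
      else (⊤ : ℕ∞)) < (k : ℕ∞))
    (hMc : (k : ℕ∞) + (if divOrd (D ⟨c, hc⟩) p < Zhang2014.levelIndex W p c then divOrd (D ⟨c, hc⟩) p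
      else ⊤) ≤ Zhang2014.levelIndex W p c)
    (hdisj : ∀ (ℓ : ℕ), Zhang2014.IsKolyvaginPrime (W.conductorNorm ℤ) W K p ℓ →
      k ≤ Zhang2014.kolyvaginIndex W p ℓ → ∀ v : HeightOneSpectrum (𝓞 K), (ℓ : 𝓞 K) ∈ v.asIdeal →
      Disjoint ((W.baseChange K).kummerSelmerStructure ((p ^ k : ℕ) : ℤ) (Sum.inr v)) (𝒯 (Sum.inr v)))
    (hfin : ∀ (m : ℕ) (v : HeightOneSpectrum (𝓞 K)),
      Finite ((selmerF W ((p ^ k : ℕ) : ℤ) 𝒯 (placesDividing K m)).relaxedAt {v}).selmerGroup)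
    (hPT : ∀ (s : {m : ℕ // Squarefree m ∧ ∀ q ∈ m.primeFactors,
        Zhang2014.IsKolyvaginPrime (W.conductorNorm ℤ) W K p q ∧ k ≤ Zhang2014.kolyvaginIndex W p q})
      (ℓ : ℕ), Zhang2014.IsKolyvaginPrime (W.conductorNorm ℤ) W K p ℓ →
      k ≤ Zhang2014.kolyvaginIndex W p ℓ → ¬ ℓ ∣ s.1 →
      ∀ v : HeightOneSpectrum (𝓞 K), (ℓ : 𝓞 K) ∈ v.asIdeal → ∀ b : Bool,
      Nat.card ((signPart W K τ ((p ^ k : ℕ) : ℤ) (if b then 1 else -1)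
          ((selmerF W ((p ^ k : ℕ) : ℤ) 𝒯 (placesDividing K s.1)).relaxedAt {v}).selmerGroup).map
        (galoisCohomology.localization ((W.baseChange K).torsionGaloisModule ((p ^ k : ℕ) : ℤ))
          (Sum.inr v) 1)) = p ^ k)
    (hκt : ∀ s, (if divOrd (D s) p < Zhang2014.levelIndex W p s.1 then divOrd (D s) p else (⊤ : ℕ∞)) +
        (k : ℕ∞) ≤ Zhang2014.levelIndex W p s.1 →
      ∃ x : galoisCohomology ((W.baseChange K).torsionGaloisModule ((p ^ k : ℕ) : ℤ)) 1,
        x ∈ signPart W K τ ((p ^ k : ℕ) : ℤ) (if eb s.1 then 1 else -1)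
          (selmerF W ((p ^ k : ℕ) : ℤ) 𝒯 (placesDividing K s.1)).selmerGroup ∧
        addOrderOf x = p ^ k ∧
        ((D s).kolyvaginClass (Fact.out : p.Prime) k :
            galoisCohomology ((W.baseChange K).torsionGaloisModule ((p ^ k : ℕ) : ℤ)) 1) =
          p ^ (if divOrd (D s) p < Zhang2014.levelIndex W p s.1 then divOrd (D s) p
            else (⊤ : ℕ∞)).toNat • x)
    (hordκ : ∀ s (j : ℕ), j < k →
      p ^ (k - j) ∣ addOrderOf ((D s).kolyvaginClass (Fact.out : p.Prime) k :
        galoisCohomology ((W.baseChange K).torsionGaloisModule ((p ^ k : ℕ) : ℤ)) 1) →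
      divOrd (D s) p ≤ (j : ℕ∞))
    (h47 : ∀ (s s' : {m : ℕ // Squarefree m ∧ ∀ q ∈ m.primeFactors,
        Zhang2014.IsKolyvaginPrime (W.conductorNorm ℤ) W K p q ∧ k ≤ Zhang2014.kolyvaginIndex W p q}) (ℓ : ℕ), ¬ ℓ ∣ s.1 → s'.1 = s.1 * ℓ →
      ∀ v : HeightOneSpectrum (𝓞 K), (ℓ : 𝓞 K) ∈ v.asIdeal →
      addOrderOf (galoisCohomology.localization ((W.baseChange K).torsionGaloisModule ((p ^ k : ℕ) : ℤ))
          (Sum.inr v) 1 ((D s').kolyvaginClass (Fact.out : p.Prime) k)) =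
        addOrderOf (galoisCohomology.localization ((W.baseChange K).torsionGaloisModule ((p ^ k : ℕ) : ℤ))
          (Sum.inr v) 1 ((D s).kolyvaginClass (Fact.out : p.Prime) k)))
    (C' : ℕ → AddSubgroup (galoisCohomology ((W.baseChange K).torsionGaloisModule ((p ^ k : ℕ) : ℤ)) 1))
    (hC : ∀ m, C' m ≤ signPart W K τ ((p ^ k : ℕ) : ℤ) (if !eb m then 1 else -1) ⊤)
    (hdual_q : ∀ s : {m : ℕ // Squarefree m ∧ ∀ q ∈ m.primeFactors,
        Zhang2014.IsKolyvaginPrime (W.conductorNorm ℤ) W K p q ∧ k ≤ Zhang2014.kolyvaginIndex W p q},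
      ∃ (Qg Qg' : Type) (_ : AddCommGroup Qg) (_ : AddCommGroup Qg') (_ : Finite Qg')
        (locq : signPart W K τ ((p ^ k : ℕ) : ℤ) (if !eb s.1 then 1 else -1)
            (selmerF W ((p ^ k : ℕ) : ℤ) 𝒯 (placesDividing K s.1)).selmerGroup →+ Qg)
        (locq' : C' s.1 →+ Qg'),
        (∀ x : C' s.1, locq' x = 0 ↔
          (x : galoisCohomology ((W.baseChange K).torsionGaloisModule ((p ^ k : ℕ) : ℤ)) 1) ∈
            signPart W K τ ((p ^ k : ℕ) : ℤ) (if !eb s.1 then 1 else -1)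
              (selmerF W ((p ^ k : ℕ) : ℤ) 𝒯 (placesDividing K s.1)).selmerGroup) ∧
        Nat.card locq.range * Nat.card locq'.range = Nat.card Qg' ∧ IsAddCyclic Qg' ∧
        Nat.card Qg' = p ^ t)
    (h49 : ∀ (s s' : {m : ℕ // Squarefree m ∧ ∀ q ∈ m.primeFactors,
        Zhang2014.IsKolyvaginPrime (W.conductorNorm ℤ) W K p q ∧ k ≤ Zhang2014.kolyvaginIndex W p q}) (ℓ : ℕ), ¬ ℓ ∣ s.1 → s'.1 = s.1 * ℓ →
      ∀ v : HeightOneSpectrum (𝓞 K), (ℓ : 𝓞 K) ∈ v.asIdeal →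
      ((D s').kolyvaginClass (Fact.out : p.Prime) k :
          galoisCohomology ((W.baseChange K).torsionGaloisModule ((p ^ k : ℕ) : ℤ)) 1) ∈
        signPart W K τ ((p ^ k : ℕ) : ℤ) (if !eb s.1 then 1 else -1)
          (((selmerF0 W ((p ^ k : ℕ) : ℤ) 𝒯 𝒮 (placesDividing K s.1) Qcar).relaxedAt {v}).selmerGroup))
    (hdual_ℓ : ∀ (s : {m : ℕ // Squarefree m ∧ ∀ q ∈ m.primeFactors,
        Zhang2014.IsKolyvaginPrime (W.conductorNorm ℤ) W K p q ∧ k ≤ Zhang2014.kolyvaginIndex W p q})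
      (ℓ : ℕ), Zhang2014.IsKolyvaginPrime (W.conductorNorm ℤ) W K p ℓ →
      k ≤ Zhang2014.kolyvaginIndex W p ℓ → ¬ ℓ ∣ s.1 →
      ∀ v : HeightOneSpectrum (𝓞 K), (ℓ : 𝓞 K) ∈ v.asIdeal →
      ∃ (Sg : Type) (_ : AddCommGroup Sg)
        (sing : signPart W K τ ((p ^ k : ℕ) : ℤ) (if !eb s.1 then 1 else -1)
            (((selmerF0 W ((p ^ k : ℕ) : ℤ) 𝒯 𝒮 (placesDividing K s.1) Qcar).relaxedAt {v}).selmerGroup)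
          →+ Sg),
        (∀ x, sing x = 0 ↔
          (x : galoisCohomology ((W.baseChange K).torsionGaloisModule ((p ^ k : ℕ) : ℤ)) 1) ∈
            signPart W K τ ((p ^ k : ℕ) : ℤ) (if !eb s.1 then 1 else -1)
              ((selmerF0 W ((p ^ k : ℕ) : ℤ) 𝒯 𝒮 (placesDividing K s.1) Qcar).selmerGroup)) ∧
        Nat.card sing.range *
          Nat.card ((C' s.1).map (galoisCohomology.localization
            ((W.baseChange K).torsionGaloisModule ((p ^ k : ℕ) : ℤ)) (Sum.inr v) 1)) = p ^ k) :
    (t : ℕ∞) ≤ (if divOrd (D ⟨c, hc⟩) p < Zhang2014.levelIndex W p c then divOrd (D ⟨c, hc⟩) p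
      else ⊤) := by
  have hp : p.Prime := Fact.out
  have hc0 : c ≠ 0 := hc.1.ne_zero
  -- ### `u := m(c)` as a natural number
  set mcc : ℕ∞ := (if divOrd (D ⟨c, hc⟩) p < Zhang2014.levelIndex W p c then divOrd (D ⟨c, hc⟩) p
    else (⊤ : ℕ∞)) with hmcc_def
  have hmcc_ne : mcc ≠ ⊤ := ne_top_of_lt h0
  set u : ℕ := mcc.toNat with hu
  have hmcu : mcc = (u : ℕ∞) := (ENat.coe_toNat hmcc_ne).symm
  have hku : ((k + u : ℕ) : ℕ∞) = (k : ℕ∞) + mcc := by rw [hmcu]; push_cast; rfl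
  have hcidx : ∀ q ∈ c.primeFactors, k + u ≤ Zhang2014.kolyvaginIndex W p q :=
    Zhang2014.natCast_le_levelIndex_iff.mp (hku ▸ hMc)
  -- ### the pool of primes `P` and the place `λ(ℓ)`
  let P : Type := {ℓ : ℕ // Zhang2014.IsKolyvaginPrime (W.conductorNorm ℤ) W K p ℓ ∧
    k + u ≤ Zhang2014.kolyvaginIndex W p ℓ ∧ ¬ ℓ ∣ c}
  have hPprime : ∀ ℓ : P, (ℓ : ℕ).Prime := fun ℓ ↦ ℓ.2.1.1
  have hPk : ∀ ℓ : P, k ≤ Zhang2014.kolyvaginIndex W p ℓ := fun ℓ ↦ le_trans (Nat.le_add_right k u) ℓ.2.2.1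
  let lam : P → HeightOneSpectrum (𝓞 K) := fun ℓ ↦
    ⟨Ideal.span {((ℓ : ℕ) : 𝓞 K)}, ℓ.2.1.2.2.2.2.1, by
      rw [Ne, Ideal.span_singleton_eq_bot]
      exact_mod_cast (hPprime ℓ).ne_zero⟩
  have hlam_mem : ∀ ℓ : P, ((ℓ : ℕ) : 𝓞 K) ∈ (lam ℓ).asIdeal := fun ℓ ↦ Ideal.mem_span_singleton_self _
  -- ### the conductors `c·∏ n` (an opaque function with its specification)
  obtain ⟨cond, hcond⟩ : ∃ cond : Finset P → ℕ, ∀ n, cond n = c * ∏ ℓ ∈ n, (ℓ : ℕ) :=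
    ⟨_, fun _ ↦ rfl⟩
  have hcond_empty : cond ∅ = c := by rw [hcond, Finset.prod_empty, mul_one]
  have hcond_insert : ∀ (n : Finset P) (ℓ : P), ℓ ∉ n → cond (insert ℓ n) = cond n * ℓ := by
    intro n ℓ hℓ
    rw [hcond, hcond, Finset.prod_insert hℓ]
    ring
  -- admissibility of every conductor of the walk
  have hadm : ∀ n : Finset P, (Squarefree (cond n) ∧
      ∀ q ∈ (cond n).primeFactors, Zhang2014.IsKolyvaginPrime (W.conductorNorm ℤ) W K p q ∧
        k ≤ Zhang2014.kolyvaginIndex W p q) ∧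
      (∀ q ∈ (cond n).primeFactors, k + u ≤ Zhang2014.kolyvaginIndex W p q) ∧
      (∀ ℓ : P, ℓ ∉ n → ¬ (ℓ : ℕ) ∣ cond n) := by
    intro n
    obtain ⟨hsq, hfac, hnd⟩ := Walk.squarefree_mul_prod_facts (fun ℓ : P ↦ (ℓ : ℕ))
      Subtype.val_injective hPprime hc.1 (fun ℓ ↦ ℓ.2.2.2) n
    rw [hcond]
    refine ⟨⟨hsq, fun q hq ↦ ?_⟩, fun q hq ↦ ?_, hnd⟩
    · rw [hfac, Finset.mem_union, Finset.mem_image] at hq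
      rcases hq with hq | ⟨ℓ, -, rfl⟩
      · exact ⟨(hc.2 q hq).1, le_trans (Nat.le_add_right k u) (hcidx q hq)⟩
      · exact ⟨ℓ.2.1, hPk ℓ⟩
    · rw [hfac, Finset.mem_union, Finset.mem_image] at hq
      rcases hq with hq | ⟨ℓ, -, rfl⟩
      · exact hcidx q hq
      · exact ℓ.2.2.1
  -- the admissible conductor of `n`, as a point of the data subtype
  let sadm : Finset P → {m : ℕ // Squarefree m ∧ ∀ q ∈ m.primeFactors,
      Zhang2014.IsKolyvaginPrime (W.conductorNorm ℤ) W K p q ∧ k ≤ Zhang2014.kolyvaginIndex W p q} :=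
    fun n ↦ ⟨cond n, (hadm n).1⟩
  have hsadm_empty : sadm ∅ = ⟨c, hc⟩ := Subtype.ext hcond_empty
  have hsadm_insert : ∀ (n : Finset P) (ℓ : P), ℓ ∉ n → (sadm (insert ℓ n)).1 = (sadm n).1 * ℓ :=
    fun n ℓ hℓ ↦ hcond_insert n ℓ hℓ
  have hcond0 : ∀ n : Finset P, cond n ≠ 0 := fun n ↦ (hadm n).1.1.ne_zero
  have hMn : ∀ n : Finset P, (k : ℕ∞) + mcc ≤ Zhang2014.levelIndex W p (cond n) := fun n ↦ by
    rw [← hku]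
    exact Zhang2014.natCast_le_levelIndex_iff.mpr (hadm n).2.1
  -- places: `λ ∉ placesDividing (cond n)` for `ℓ ∉ n`, and the insertion rule
  have hlam_not : ∀ (n : Finset P) (ℓ : P), ℓ ∉ n → lam ℓ ∉ placesDividing K (cond n) :=
    fun n ℓ hℓ ↦ Walk.not_mem_placesDividing_of_not_dvd (hPprime ℓ) (hlam_mem ℓ) ((hadm n).2.2 ℓ hℓ)
  have hplaces_insert : ∀ (n : Finset P) (ℓ : P), ℓ ∉ n →
      placesDividing K (cond (insert ℓ n)) = insert (lam ℓ) (placesDividing K (cond n)) := by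
    intro n ℓ hℓ
    rw [hcond_insert n ℓ hℓ]
    exact Walk.placesDividing_mul_eq_insert (hcond0 n) (hPprime ℓ) ℓ.2.1.2.2.2.2.1 (hlam_mem ℓ)
  -- the carrier places avoid the places dividing the conductors
  have hQnot : ∀ (n : Finset P), ∀ v ∈ Qcar, v ∉ placesDividing K (cond n) := by
    intro n v hv hmem
    rw [SelmerVocabulary.mem_placesDividing_iff_natCast_mem (hcond0 n),
      SelmerVocabulary.natCast_mem_iff_exists_primeFactor_mem (hcond0 n)] at hmem
    obtain ⟨q, hq, hqv⟩ := hmem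
    have hqK := ((hadm n).1.2 q hq).1
    exact Method2.not_mem_asIdeal_of_coprime (K := K) ((Nat.Prime.coprime_iff_not_dvd hqK.1).mpr hqK.2.1)
      v hqv (hQcar v hv)
  -- ### block 2: Thm 5.1 at the carrier, per conductor (choice)
  choose Qg Qg' instQ instQ' instFin locq locq' hker horth_q hQcyc hQcard using
    fun n : Finset P ↦ hdual_q (sadm n)
  -- ### block 2: duality at `λ`, per (conductor, prime) — totalised in `ℓ`
  have hdl : ∀ (n : Finset P) (ℓ : P), ∃ (Sg : Type) (_ : AddCommGroup Sg)
      (sing : signPart W K τ ((p ^ k : ℕ) : ℤ) (if !eb (cond n) then 1 else -1)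
          (((selmerF0 W ((p ^ k : ℕ) : ℤ) 𝒯 𝒮 (placesDividing K (cond n)) Qcar).relaxedAt
            {lam ℓ}).selmerGroup) →+ Sg),
      ℓ ∉ n →
        ((∀ x, sing x = 0 ↔
          (x : galoisCohomology ((W.baseChange K).torsionGaloisModule ((p ^ k : ℕ) : ℤ)) 1) ∈
            signPart W K τ ((p ^ k : ℕ) : ℤ) (if !eb (cond n) then 1 else -1)
              ((selmerF0 W ((p ^ k : ℕ) : ℤ) 𝒯 𝒮 (placesDividing K (cond n)) Qcar).selmerGroup)) ∧
        Nat.card sing.range *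
          Nat.card ((C' (cond n)).map (galoisCohomology.localization
            ((W.baseChange K).torsionGaloisModule ((p ^ k : ℕ) : ℤ)) (Sum.inr (lam ℓ)) 1)) = p ^ k) := by
    intro n ℓ
    by_cases hℓ : ℓ ∈ n
    · exact ⟨PUnit, inferInstance, 0, fun h ↦ absurd hℓ h⟩
    · obtain ⟨Sg, inst, sing, h1, h2⟩ := hdual_ℓ (sadm n) ℓ ℓ.2.1 (hPk ℓ) ((hadm n).2.2 ℓ hℓ) (lam ℓ)
        (hlam_mem ℓ)
      exact ⟨Sg, inst, sing, fun _ ↦ ⟨h1, h2⟩⟩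
  choose Sg instSg sing hsing_all using hdl
  letI : ∀ n, AddCommGroup (Qg n) := instQ
  letI : ∀ n, AddCommGroup (Qg' n) := instQ'
  haveI : ∀ n, Finite (Qg' n) := instFin
  letI : ∀ n ℓ, AddCommGroup (Sg n ℓ) := instSg
  -- ### the abstract walk, instantiated
  have key := JET.Section6.tamagawaExponent_le_m_of_selmerFamilies (P := P) hp htk
    (loc := fun ℓ ↦ galoisCohomology.localization
      ((W.baseChange K).torsionGaloisModule ((p ^ k : ℕ) : ℤ)) (Sum.inr (lam ℓ)) 1)
    (Hf := fun ℓ _ ↦ (W.baseChange K).kummerSelmerStructure ((p ^ k : ℕ) : ℤ) (Sum.inr (lam ℓ)))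
    (Htr := fun ℓ _ ↦ 𝒯 (Sum.inr (lam ℓ)))
    ?hdisj
    (Gs := fun b ↦ signPart W K τ ((p ^ k : ℕ) : ℤ) (if b then 1 else -1) ⊤)
    (Sel := fun n b ↦ signPart W K τ ((p ^ k : ℕ) : ℤ) (if b then 1 else -1)
      (selmerF W ((p ^ k : ℕ) : ℤ) 𝒯 (placesDividing K (cond n))).selmerGroup)
    (Rel := fun n ℓ b ↦ signPart W K τ ((p ^ k : ℕ) : ℤ) (if b then 1 else -1)
      ((selmerF W ((p ^ k : ℕ) : ℤ) 𝒯 (placesDividing K (cond n))).relaxedAt {lam ℓ}).selmerGroup)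
    ?hSelGs ?hfin ?hSel ?hSelT ?hPT
    (e := fun n ↦ eb (cond n)) ?he ?h61
    (M := fun n ↦ Zhang2014.levelIndex W p (cond n))
    (mdiv := fun n ↦ divOrd (D (sadm n)) p)
    (mc := fun n ↦ if divOrd (D (sadm n)) p < Zhang2014.levelIndex W p (cond n)
      then divOrd (D (sadm n)) p else ⊤)
    ?hm ?hM
    (κ := fun n ↦ ((D (sadm n)).kolyvaginClass hp k :
      galoisCohomology ((W.baseChange K).torsionGaloisModule ((p ^ k : ℕ) : ℤ)) 1))
    (κt := fun n ↦ if h : (if divOrd (D (sadm n)) p < Zhang2014.levelIndex W p (cond n)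
        then divOrd (D (sadm n)) p else (⊤ : ℕ∞)) + (k : ℕ∞) ≤ Zhang2014.levelIndex W p (cond n)
      then Classical.choose (hκt (sadm n) h) else 0)
    ?hκt ?hordκ ?h47 ?h0
    (B' := fun n ↦ signPart W K τ ((p ^ k : ℕ) : ℤ) (if !eb (cond n) then 1 else -1)
      (selmerF0 W ((p ^ k : ℕ) : ℤ) 𝒯 𝒮 (placesDividing K (cond n)) Qcar).selmerGroup)
    (C' := fun n ↦ C' (cond n)) ?hB' ?hC'Gs
    (Q := Qg) (Q' := Qg') (locq := locq) (locq' := locq') hker horth_q hQcyc hQcard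
    (D' := fun n ℓ ↦ signPart W K τ ((p ^ k : ℕ) : ℤ) (if !eb (cond n) then 1 else -1)
      (((selmerF0 W ((p ^ k : ℕ) : ℤ) 𝒯 𝒮 (placesDividing K (cond n)) Qcar).relaxedAt
        {lam ℓ}).selmerGroup))
    (S := Sg) (sing := sing) ?hsing ?horthl ?h49
  · -- read the conclusion at the empty conductor `cond ∅ = c`
    beta_reduce at key
    rwa [hsadm_empty, hcond_empty] at key
  case hdisj =>
    intro ℓ b
    exact hdisj ℓ ℓ.2.1 (hPk ℓ) (lam ℓ) (hlam_mem ℓ)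
  case hSelGs =>
    intro n b
    exact Walk.signPart_le_signPart_top W K τ _ _ _
  case hfin =>
    intro n ℓ b _
    haveI := hfin (cond n) (lam ℓ)
    exact Finite.of_injective _ (AddSubgroup.inclusion_injective (inf_le_left
      (a := ((selmerF W ((p ^ k : ℕ) : ℤ) 𝒯 (placesDividing K (cond n))).relaxedAt {lam ℓ}).selmerGroup)
      (b := (conjActH1 W K τ ((p ^ k : ℕ) : ℤ) - (if b then (1 : ℤ) else -1) •
        AddMonoidHom.id _).ker)))
  case hSel =>
    intro n ℓ b hℓ
    show signPart W K τ _ _ (selmerF W _ 𝒯 (placesDividing K (cond n))).selmerGroup = _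
    rw [← Walk.signPart_inf_right]
    congr 1
    exact Walk.selmerGroup_transverseAt_eq_relaxedAt_inf _ 𝒯 (hlam_not n ℓ hℓ)
  case hSelT =>
    intro n ℓ b hℓ
    show signPart W K τ _ _ (selmerF W _ 𝒯 (placesDividing K (cond (insert ℓ n)))).selmerGroup = _
    rw [hplaces_insert n ℓ hℓ, ← Walk.signPart_inf_right]
    congr 1
    exact Walk.selmerGroup_transverseAt_insert _ 𝒯 _ (lam ℓ)
  case hPT =>
    intro n ℓ b hℓ
    exact hPT (sadm n) ℓ ℓ.2.1 (hPk ℓ) ((hadm n).2.2 ℓ hℓ) (lam ℓ) (hlam_mem ℓ) b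
  case he =>
    intro n ℓ hℓ
    rw [hcond_insert n ℓ hℓ]
    exact heb (cond n) ℓ (hPprime ℓ) ((hadm n).2.2 ℓ hℓ)
  case h61 =>
    intro b x y hx hy hy0 n
    rw [Walk.mem_signPart_top_iff] at hx hy
    have hes : ((if b then (1 : ℤ) else -1) = 1 ∨ (if b then (1 : ℤ) else -1) = -1) := by
      cases b <;> simp
    have hy' : conjAct W τ ((p ^ k : ℕ) : ℤ) y = (-(if b then (1 : ℤ) else -1)) • y := by
      rw [hy]; cases b <;> simp
    obtain ⟨ℓ₀, hℓS, hℓc, hZ, hidx, hord⟩ :=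
      Walk.exists_fresh_kolyvaginPrime_addOrderOf_localization_eq W hK hp2 hρ τ hτ hk u hes x y hx hy'
        hy0 (n.image fun ℓ : P ↦ (ℓ : ℕ)) hc0
    refine ⟨⟨ℓ₀, hZ, hidx, hℓc⟩, fun hmem ↦ hℓS (Finset.mem_image_of_mem _ hmem), ?_⟩
    exact hord (lam ⟨ℓ₀, hZ, hidx, hℓc⟩) (hlam_mem _)
  case hm =>
    intro n h
    rw [if_pos h]
  case hM =>
    intro n
    rw [hsadm_empty, hcond_empty]
    exact hMn n
  case hκt =>
    intro n h
    simp only [dif_pos h]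
    exact Classical.choose_spec (hκt (sadm n) h)
  case hordκ =>
    intro n j hj hdvd
    exact hordκ (sadm n) j hj hdvd
  case h47 =>
    intro n ℓ hℓ
    exact h47 (sadm n) (sadm (insert ℓ n)) ℓ ((hadm n).2.2 ℓ hℓ) (hsadm_insert n ℓ hℓ) (lam ℓ)
      (hlam_mem ℓ)
  case h0 =>
    rw [hsadm_empty, hcond_empty]
    exact h0
  case hB' =>
    intro n
    exact signPart_mono W K τ _ _ (Walk.selmerGroup_selmerF0_le W _ 𝒯 𝒮 hS (hQnot n))
  case hC'Gs =>
    intro n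
    exact hC (cond n)
  case hsing =>
    intro n ℓ x hℓ
    exact (hsing_all n ℓ hℓ).1 x
  case horthl =>
    intro n ℓ hℓ
    exact (hsing_all n ℓ hℓ).2
  case h49 =>
    intro n ℓ hℓ
    exact h49 (sadm n) (sadm (insert ℓ n)) ℓ ((hadm n).2.2 ℓ hℓ) (hsadm_insert n ℓ hℓ) (lam ℓ)
      (hlam_mem ℓ)

end Summit.BirchSwinnertonDyer.Rank1Residual.X11b.Three.Koly

end
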